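import Summits.QuantumFields.BalabanUV.Beta.FP.SliceVertexLoops

/-!
# `BalabanUV.Beta.FP.SlicePairing` — road «FP» for binder row D1, row **GAMMA-5** (PAIRING WITH `K`'s SLICE LOOPS, MODEL) of the owner's `GAMMA-DESIGN.md`
# §6 ∕ §7 (b2b-balaban-beta-d1-p3 gen 6, ruling R-FP-25; owner NOTE → GAMMA-5 holders, journal l.24181): THE ONE SHOT'S COVARIANT-SLICE LOOPS MINUS
# `K`'s BF-FEYNMAN SLICE LOOPS, TERM BY TERM — EVERY REMAINDER CARRIES A FACTOR FROM {`(1 − Π)` ∕ `Π̇`, `E = Gh − G₀`, `R = P − Γ`} — AND THE STRUCTURE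
# OF THE LEG REMAINDER `R` (the invariant Hessian collapses it onto ghost-remainder ∕ `(1 − Π)` ∕ constraint pieces)

HONEST DEPENDENCY (page 1, mandatory): continuum YM on T⁴ ⇐ BetaPertH ∧ nine spine estimates (0/9 proved); BetaPertH ⇐ (D1) ∧ (D4) ∧ CAP+tail;
G-an2-4 gates asym, D1 and NE2/3/4.  HONEST FRAMING (cell contract, verbatim): «discharging `BetaPertH` makes Bałaban's UV stability UNCONDITIONAL —
a real constructive-QFT result; it is NOT the continuum limit and NOT the Clay problem.»  THIS MODULE is [folklore] block ∕ projector algebra of finite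
matrices over a field (`FP/SliceVertexLoops` = row GAMMA-4 PART 1, `FP/SliceWardKKT` = row RHOA-11 and b12's `CompositionSingular` dictionary BY NAME);
it asserts nothing about Bałaban's operators, identifies NO road object (`P`, `G₀`, `Gh`, `Π`, `d` are ABSTRACT matrices carrying displayed letters; the road's
instances live ELSEWHERE), proves no letter, no estimate, no power counting (GAMMA-6), no ghost pairing (GAMMA-9), no MIX loop; cites nothing, mints no `Prop` fact,
has no `def`; 0 sorry.  An exact-ℚ engine of the SAME algebra on generic rational data satisfying the letters (`HOME/b2b-balaban-gan24-formalise-leaf-01/g50/engine/`,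
37∕37 identities ×3 seeds, 5 negative controls) was run BEFORE typing, as the owner asked.  NOT hbook, NOT hgerm, NOT D1, NOT BetaPertH, NOT continuum, NOT Clay.

ABSOLUTE RULE (cell charter, verbatim): «No internally-minted statement may enter as a cited fact. Every hypothesis is either kernel-proved in this
package or a verbatim quotation of a PUBLISHED theorem with page reference. The manuscript(s) under audit are NOT citable for their own disputed
steps — they are the thing under adjudication; programme-internal (2001/route/tribunal) claims are never citable.»

THE MODEL (GAMMA-DESIGN §4 ∕ §6).  ONE-SHOT SIDE exactly as GAMMA-4 (`H := H₀ + D·Pg·Dᵀ`, `D` = the gradient `d`, `Pg` = the projector `Π` — a reserved token — `Q`,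
`Γ := flucCov H Q`, `𝓘 := minOp H Q`, `𝓘ᴸ := minOpL H Q`; test family `X` spanning `ker Q′` with (hQ) `Q·D·X = 0`, (hH₀) `H₀·D·X = 0`, RANGE `Pg = (Dᵀ·D)·X·T`, `Pg·Pg = Pg`,
GHOST `Gh·(Dᵀ·D)·X = X`, symmetry `H₀ᵀ = H₀`, `Pgᵀ = Pg`, `Ghᵀ = Gh`, jet letter `Pd = Pd·Pg + Pg·Pd`; `Ṡ := Dd·Pg·Dᵀ + D·Pd·Dᵀ + D·Pg·Ddᵀ`, `S̈` as in GAMMA-4 PART 2).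
`K`'s SIDE (BF-Feynman gauge: slice `d·d^*`, no projector, no constraint): a leg `P : Matrix ν ν 𝕜` and a FULL ghost `G₀ : Matrix σ σ 𝕜` with the BF WARD LETTERS
(bf1) `P·D = D·G₀`, (bf2) `Dᵀ·P = G₀·Dᵀ` (model form of «`d^*P_BF = G₀d^*`, `P_BFd = dG₀`»); slice jets `Ṡ_BF := Dd·Dᵀ + D·Ddᵀ`, `S̈_BF := Ddd·Dᵀ + D·Dddᵀ + (Dd·Ddᵀ)×2`.
REMAINDERS, written INLINE: `R := P − Γ`, `E := Gh − G₀` (`ghostRem`).  The WILSON-BF INSTANCE adds the letters `H₀·D = 0` (full gauge invariance), `(Dᵀ·D)·G₀ = 1 =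
G₀·(Dᵀ·D)`, `P·(H₀ + D·Dᵀ) = 1 = (H₀ + D·Dᵀ)·P`, under which (bf1)(bf2) are DERIVED (§1) and `R` has the closed forms of §4.

WHAT IS PROVED.  §1 `K`'s slice sandwiches **(K1) `P·Ṡ_BF·P = P·ḋ·G₀·Dᵀ + D·G₀·ḋᵀ·P`**, (K2) `tr(P·S̈_BF)`; the Wilson-BF instance derives (bf1)(bf2).  §2 slice-jet
differences (J1) `Ṡ − Ṡ_BF = −ḋ·(1−Π)·Dᵀ + D·Π̇·Dᵀ − D·(1−Π)·ḋᵀ`, (J2) `S̈ − S̈_BF`.  §3 THE PAIRING: **(P×) `Γ·Ṡ·Γ − P·Ṡ_BF·P` = eight remainder terms**, each with exactly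
one factor from {`(1−Π)`∕`Π̇`, `E`, `R`} (+ contraction with any `A = Ḣ_act[β]`); (P∘) bubble and (P·) tadpole differences reduced to (P×), (J1), (J2), `R`; (P0) pure-action
loops `Γ·A·Γ − P·A·P = −(R·A·P + Γ·A·R)`.  §4 STRUCTURE OF `R` (Wilson-BF instance): **(R1) `R = −D·G₀·(1−Π)·Dᵀ·Γ + P·Qᵀ·𝓘ᴸ`** + mirror; **(R2) `H₀·R = D·E·Dᵀ −
D·(1−Π)·Gh·Dᵀ + Qᵀ·𝓘ᴸ = (1 − D·G₀·Dᵀ)·Qᵀ·𝓘ᴸ`**; (R3) `Dᵀ·R = −E·Dᵀ + (1−Π)·(Gh·Dᵀ − Dᵀ·Γ)`; (R4) `H₀·P = 1 − D·G₀·Dᵀ`; (R5) `H₀·Γ = 1 − D·Π·Gh·Dᵀ − Qᵀ·𝓘ᴸ`.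
§5 THE VERTEX-WARD REDUCTION of the cross `R`-term under the ABSTRACT contact letter (VW) `A·D = −(H₀·ḋ + Ct)` (road instance = H2V-DESIGN §2
(a4)+(a6), NOT asserted here): `tr(A·R·ḋ′·G₀·Dᵀ) = −tr(ḋᵀ·(1 − D·G₀·Dᵀ)·Qᵀ·𝓘ᴸ·ḋ′·G₀) − tr(Ctᵀ·R·ḋ′·G₀)` — the `H₀`-leg collapses onto the constraint vertex.
Provenance: G-an2-4 formalisation swarm seat b2b-balaban-gan24-formalise-leaf-01 gen 50 (cross-lane on road FP, row GAMMA-5), 2026-08-21.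
-/

namespace Summit.QuantumFields.BalabanUV.Beta.FP.SlicePairing

open scoped Matrix
open Matrix
open Literature.MathematicalPhysics.QuantumFieldTheory.Balaban1983to89.Beta.Composition (kkt)
open Literature.MathematicalPhysics.QuantumFieldTheory.Balaban1983to89.Beta.CompositionSingular (flucCov minOp minOpL kkt_mul_blocks blocks_mul_kkt)
open Summit.QuantumFields.BalabanUV.Beta.FP.SliceVertexLoops (flucCov_D_proj proj_Dt_flucCov sandwich_flucCov_flucCov)

variable {𝕜 : Type*} [Field 𝕜]

/-! ## §1 `K`'s side: the BF-Feynman slice sandwiches and the Wilson-BF instance of the BF Ward letters -/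

section KSide

variable {ν σ : Type*} [Fintype ν] [Fintype σ]
variable {P H₀ : Matrix ν ν 𝕜} {D Dd Ddd : Matrix ν σ 𝕜} {G₀ : Matrix σ σ 𝕜}

/-- [our object] **(K1) `K`'s FIRST-JET SLICE SANDWICH** `P·Ṡ_BF·P = P·ḋ·G₀·Dᵀ + D·G₀·ḋᵀ·P` (`Ṡ_BF = ḋ·Dᵀ + D·ḋᵀ`): by the BF Ward letters every
slice leg of the BF-Feynman loop is a FULL-ghost leg — the `K`-side twin of GAMMA-4's (E1). -/
theorem bf_sandwich (hbf1 : P * D = D * G₀) (hbf2 : Dᵀ * P = G₀ * Dᵀ) :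
    P * (Dd * Dᵀ + D * Ddᵀ) * P = P * Dd * G₀ * Dᵀ + D * G₀ * Ddᵀ * P := by
  have t1 : P * (Dd * Dᵀ) * P = P * Dd * G₀ * Dᵀ := by simp only [Matrix.mul_assoc, hbf2]
  have t2 : P * (D * Ddᵀ) * P = D * G₀ * Ddᵀ * P := by
    calc P * (D * Ddᵀ) * P = (P * D) * Ddᵀ * P := by simp only [Matrix.mul_assoc]
      _ = D * G₀ * Ddᵀ * P := by rw [hbf1]
  rw [Matrix.mul_add, Matrix.add_mul, t1, t2]

/-- [our object] (K2) `K`'s SECOND-JET SLICE TADPOLE: `tr(P·S̈_BF) = tr(d̈·G₀·Dᵀ) + tr(D·G₀·d̈ᵀ) + tr(P·ḋ·ḋᵀ)×2`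
(`S̈_BF = d̈·Dᵀ + D·d̈ᵀ + (ḋ·ḋᵀ)×2`, the `×2` spelled as a sum): two full-ghost tadpoles and the `ḋḋᵀ` contact. -/
theorem trace_bf_jet2 (hbf1 : P * D = D * G₀) (hbf2 : Dᵀ * P = G₀ * Dᵀ) :
    (P * (Ddd * Dᵀ + D * Dddᵀ + (Dd * Ddᵀ + Dd * Ddᵀ))).trace =
      (Ddd * G₀ * Dᵀ).trace + (D * G₀ * Dddᵀ).trace + ((P * (Dd * Ddᵀ)).trace + (P * (Dd * Ddᵀ)).trace) := by
  have t1 : (P * (Ddd * Dᵀ)).trace = (Ddd * G₀ * Dᵀ).trace := by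
    rw [Matrix.trace_mul_comm, Matrix.mul_assoc, hbf2, ← Matrix.mul_assoc]
  have t2 : P * (D * Dddᵀ) = D * G₀ * Dddᵀ := by rw [← Matrix.mul_assoc, hbf1]
  simp only [Matrix.mul_add, Matrix.trace_add, t1, t2]

end KSide

section WilsonBF

variable {ν σ : Type*} [Fintype ν] [Fintype σ] [DecidableEq ν] [DecidableEq σ]
variable {P H₀ : Matrix ν ν 𝕜} {D : Matrix ν σ 𝕜} {G₀ : Matrix σ σ 𝕜}

/-- [folklore] WILSON-BF INSTANCE, right Ward letter: full gauge invariance `H₀·D = 0`, a left inverse `P·(H₀ + D·Dᵀ) = 1` and a right ghost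
`(Dᵀ·D)·G₀ = 1` give **(bf1) `P·D = D·G₀`** («`P_BF·d = d·G₀`»). -/
theorem bf_ward_right (hH₀D : H₀ * D = 0) (hPl : P * (H₀ + D * Dᵀ) = 1) (hG₀ : Dᵀ * D * G₀ = 1) : P * D = D * G₀ := by
  have e : P * (H₀ + D * Dᵀ) * D = D := by rw [hPl, Matrix.one_mul]
  rw [Matrix.mul_add, Matrix.add_mul, Matrix.mul_assoc P H₀ D, hH₀D, Matrix.mul_zero, zero_add] at e
  calc P * D = P * D * (Dᵀ * D * G₀) := by rw [hG₀, Matrix.mul_one]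
    _ = (P * (D * Dᵀ) * D) * G₀ := by simp only [Matrix.mul_assoc]
    _ = D * G₀ := by rw [e]

/-- [folklore] WILSON-BF INSTANCE, left Ward letter: `H₀ᵀ = H₀`, `H₀·D = 0`, a right inverse `(H₀ + D·Dᵀ)·P = 1` and a left ghost `G₀·(Dᵀ·D) = 1`
give **(bf2) `Dᵀ·P = G₀·Dᵀ`** («`d^*·P_BF = G₀·d^*`»). -/
theorem bf_ward_left (hH₀t : H₀ᵀ = H₀) (hH₀D : H₀ * D = 0) (hPr : (H₀ + D * Dᵀ) * P = 1) (hG₀ : G₀ * (Dᵀ * D) = 1) : Dᵀ * P = G₀ * Dᵀ := by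
  have hDH : Dᵀ * H₀ = 0 := by simpa only [Matrix.transpose_mul, hH₀t, Matrix.transpose_zero] using congrArg Matrix.transpose hH₀D
  have e : Dᵀ * ((H₀ + D * Dᵀ) * P) = Dᵀ := by rw [hPr, Matrix.mul_one]
  rw [← Matrix.mul_assoc, Matrix.mul_add, hDH, zero_add] at e
  calc Dᵀ * P = G₀ * (Dᵀ * D) * (Dᵀ * P) := by rw [hG₀, Matrix.one_mul]
    _ = G₀ * (Dᵀ * (D * Dᵀ) * P) := by simp only [Matrix.mul_assoc]
    _ = G₀ * Dᵀ := by rw [e]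

end WilsonBF

/-! ## §2 The slice-jet differences (pure algebra) -/

section Jets

variable {ν σ : Type*} [Fintype σ] [DecidableEq σ]
variable {D Dd Ddd : Matrix ν σ 𝕜} {Pg Pd Pdd : Matrix σ σ 𝕜}

/-- [folklore] **(J1)** `Ṡ − Ṡ_BF = −ḋ·(1−Π)·Dᵀ + D·Π̇·Dᵀ − D·(1−Π)·ḋᵀ`: the covariant and the BF-Feynman first slice jets differ by `(1−Π)`- and `Π̇`-pieces only. -/
theorem slice_jet_sub :
    (Dd * Pg * Dᵀ + D * Pd * Dᵀ + D * Pg * Ddᵀ) - (Dd * Dᵀ + D * Ddᵀ) = -(Dd * (1 - Pg) * Dᵀ) + D * Pd * Dᵀ - D * (1 - Pg) * Ddᵀ := by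
  simp only [Matrix.mul_sub, Matrix.sub_mul, Matrix.mul_one]; abel

/-- [folklore] **(J2)** `S̈ − S̈_BF = −d̈·(1−Π)·Dᵀ − D·(1−Π)·d̈ᵀ + D·Π̈·Dᵀ + (ḋ·Π̇·Dᵀ)×2 + (D·Π̇·ḋᵀ)×2 − (ḋ·(1−Π)·ḋᵀ)×2` (the `×2` as sums, GAMMA-4's
convention): the second slice jets differ by `(1−Π)`-, `Π̇`- and `Π̈`-pieces only. -/
theorem slice_jet2_sub :
    (Ddd * Pg * Dᵀ + D * Pg * Dddᵀ + D * Pdd * Dᵀ + (Dd * Pd * Dᵀ + Dd * Pd * Dᵀ) + (Dd * Pg * Ddᵀ + Dd * Pg * Ddᵀ) +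
        (D * Pd * Ddᵀ + D * Pd * Ddᵀ)) - (Ddd * Dᵀ + D * Dddᵀ + (Dd * Ddᵀ + Dd * Ddᵀ)) =
      -(Ddd * (1 - Pg) * Dᵀ) - D * (1 - Pg) * Dddᵀ + D * Pdd * Dᵀ + (Dd * Pd * Dᵀ + Dd * Pd * Dᵀ) + (D * Pd * Ddᵀ + D * Pd * Ddᵀ) -
        (Dd * (1 - Pg) * Ddᵀ + Dd * (1 - Pg) * Ddᵀ) := by
  simp only [Matrix.mul_sub, Matrix.sub_mul, Matrix.mul_one]; abel

end Jets

/-! ## §3 The pairing -/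

section Generic

variable {ν : Type*} [Fintype ν]

/-- [folklore] **(P∘) THE BUBBLE DIFFERENCE, generic**: `tr(X·S·X·S) − tr(Y·S′·Y·S′) = tr((X·S·X − Y·S′·Y)·S) + tr(Y·S′·Y·(S − S′))` — the slice–slice
bubble of the one shot minus `K`'s is (cross-sandwich difference)×(slice jet) + (`K`'s sandwich)×(slice-jet difference). -/
theorem trace_bubble_sub (X S Y S' : Matrix ν ν 𝕜) :
    (X * S * X * S).trace - (Y * S' * Y * S').trace = ((X * S * X - Y * S' * Y) * S).trace + (Y * S' * Y * (S - S')).trace := by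
  rw [Matrix.sub_mul, Matrix.mul_sub, Matrix.trace_sub, Matrix.trace_sub]
  abel

/-- [folklore] **(P·) THE TADPOLE DIFFERENCE, generic**: `tr(Γ·S₂) − tr(P·S₂′) = tr(Γ·(S₂ − S₂′)) − tr((P − Γ)·S₂′)`. -/
theorem trace_tadpole_sub (Γ P S₂ S₂' : Matrix ν ν 𝕜) :
    (Γ * S₂).trace - (P * S₂').trace = (Γ * (S₂ - S₂')).trace - ((P - Γ) * S₂').trace := by
  rw [Matrix.mul_sub, Matrix.sub_mul, Matrix.trace_sub, Matrix.trace_sub]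
  abel

/-- [folklore] bookkeeping: `Γ − X + Y = P ⟹ P − Γ = −X + Y`. -/
theorem sub_eq_neg_add_of_eq {α : Type*} [AddCommGroup α] {Γ X Y P : α} (e : Γ - X + Y = P) : P - Γ = -X + Y := by rw [← e]; abel

/-- [folklore] **(P0) THE PURE-ACTION LEG PAIRING**: `Γ·A·Γ − P·A·P = −((P − Γ)·A·P + Γ·A·(P − Γ))` — GAMMA-DESIGN §6 (i): gluon-leg remainders carry `R = P − Γ`. -/
theorem leg_sandwich_sub (Γ P A : Matrix ν ν 𝕜) : Γ * A * Γ - P * A * P = -((P - Γ) * A * P + Γ * A * (P - Γ)) := by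
  noncomm_ring

/-- [folklore] (P0, tadpole) `tr(Γ·Ä) − tr(P·Ä) = −tr((P − Γ)·Ä)`. -/
theorem trace_leg_tadpole_sub (Γ P A₂ : Matrix ν ν 𝕜) : (Γ * A₂).trace - (P * A₂).trace = -((P - Γ) * A₂).trace := by
  rw [Matrix.sub_mul, Matrix.trace_sub]
  abel

/-- [folklore] (P0, bubble) `tr(Γ·A·Γ·A) − tr(P·A·P·A) = −tr((P − Γ)·A·P·A) − tr(Γ·A·(P − Γ)·A)`. -/
theorem trace_leg_bubble_sub (Γ P A : Matrix ν ν 𝕜) :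
    (Γ * A * Γ * A).trace - (P * A * P * A).trace = -((P - Γ) * A * P * A).trace - (Γ * A * (P - Γ) * A).trace := by
  have e : Γ * A * Γ * A - P * A * P * A = -((P - Γ) * A * P * A) - Γ * A * (P - Γ) * A := by noncomm_ring
  rw [← Matrix.trace_sub, e, Matrix.trace_sub, Matrix.trace_neg]

end Generic

section Pairing

variable {ν μ κ σ : Type*} [Fintype ν] [Fintype μ] [Fintype κ] [Fintype σ] [DecidableEq ν] [DecidableEq μ] [DecidableEq σ]
variable {H₀ P A : Matrix ν ν 𝕜} {Q : Matrix μ ν 𝕜} {D Dd : Matrix ν σ 𝕜} {Pg Pd Gh G₀ : Matrix σ σ 𝕜} {X : Matrix σ κ 𝕜} {T : Matrix κ σ 𝕜}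

/-- [our object] **(P×) THE CROSS-SANDWICH PAIRING** (GAMMA-DESIGN §6 «(ii) − [K's slice loops]», term by term): with `Γ := flucCov (H₀ + D·Π·Dᵀ) Q`,
`R := P − Γ`, `E := Gh − G₀`,
`Γ·Ṡ·Γ − P·Ṡ_BF·P = −Γ·ḋ·(1−Π)·Gh·Dᵀ − D·Gh·(1−Π)·ḋᵀ·Γ + Γ·ḋ·E·Dᵀ + D·E·ḋᵀ·Γ − R·ḋ·G₀·Dᵀ − D·G₀·ḋᵀ·R + D·Gh·Π·Π̇·(1−Π)·Dᵀ·Γ + Γ·D·(1−Π)·Π̇·Π·Gh·Dᵀ`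
— EVERY remainder carries exactly one factor from {`(1−Π)`∕`Π̇`, `E`, `R`} ((E1) of GAMMA-4 and (K1) above, then free-ring algebra). -/
theorem cross_sandwich_sub (h : IsUnit (kkt (H₀ + D * Pg * Dᵀ) Q).det) (hH₀t : H₀ᵀ = H₀) (hPt : Pgᵀ = Pg) (hGht : Ghᵀ = Gh)
    (hQ : Q * D * X = 0) (hH₀ : H₀ * D * X = 0) (hP : Pg * Pg = Pg) (hrange : Pg = Dᵀ * D * X * T) (hGh : Gh * (Dᵀ * D) * X = X)
    (hd : Pd = Pd * Pg + Pg * Pd) (hbf1 : P * D = D * G₀) (hbf2 : Dᵀ * P = G₀ * Dᵀ) :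
    flucCov (H₀ + D * Pg * Dᵀ) Q * (Dd * Pg * Dᵀ + D * Pd * Dᵀ + D * Pg * Ddᵀ) * flucCov (H₀ + D * Pg * Dᵀ) Q - P * (Dd * Dᵀ + D * Ddᵀ) * P =
      -(flucCov (H₀ + D * Pg * Dᵀ) Q * Dd * (1 - Pg) * Gh * Dᵀ) - D * Gh * (1 - Pg) * Ddᵀ * flucCov (H₀ + D * Pg * Dᵀ) Q +
        flucCov (H₀ + D * Pg * Dᵀ) Q * Dd * (Gh - G₀) * Dᵀ + D * (Gh - G₀) * Ddᵀ * flucCov (H₀ + D * Pg * Dᵀ) Q -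
        (P - flucCov (H₀ + D * Pg * Dᵀ) Q) * Dd * G₀ * Dᵀ - D * G₀ * Ddᵀ * (P - flucCov (H₀ + D * Pg * Dᵀ) Q) +
        D * Gh * Pg * Pd * (1 - Pg) * Dᵀ * flucCov (H₀ + D * Pg * Dᵀ) Q + flucCov (H₀ + D * Pg * Dᵀ) Q * D * (1 - Pg) * Pd * Pg * Gh * Dᵀ := by
  rw [sandwich_flucCov_flucCov h hH₀t hPt hGht hQ hH₀ hP hrange hGh hd, bf_sandwich hbf1 hbf2]
  simp only [Matrix.mul_sub, Matrix.sub_mul, Matrix.mul_one, Matrix.mul_assoc]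
  abel

/-- [our object] (P×′) THE OWNER'S SIX-TERM REGROUPING (d1-p3-g7 twin `FP-SlicePairing.v1.staged` a82f4c486f4c6be9, `pairing_first_jet`; journal l.24965): with
`R′ := Γ − P` and `Π·Gh − G₀ = E − (1−Π)·Gh`, `Γ·Ṡ·Γ − P·Ṡ_BF·P = R′·ḋ·Π·Gh·Dᵀ + D·Gh·Π·ḋᵀ·R′ + P·ḋ·(E − (1−Π)·Gh)·Dᵀ + D·(E − Gh·(1−Π))·ḋᵀ·P + [the two Π̇ terms]`
— the free consistency check of the two regroupings asked for in that line. -/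
theorem cross_sandwich_sub' (h : IsUnit (kkt (H₀ + D * Pg * Dᵀ) Q).det) (hH₀t : H₀ᵀ = H₀) (hPt : Pgᵀ = Pg) (hGht : Ghᵀ = Gh)
    (hQ : Q * D * X = 0) (hH₀ : H₀ * D * X = 0) (hP : Pg * Pg = Pg) (hrange : Pg = Dᵀ * D * X * T) (hGh : Gh * (Dᵀ * D) * X = X)
    (hd : Pd = Pd * Pg + Pg * Pd) (hbf1 : P * D = D * G₀) (hbf2 : Dᵀ * P = G₀ * Dᵀ) :
    flucCov (H₀ + D * Pg * Dᵀ) Q * (Dd * Pg * Dᵀ + D * Pd * Dᵀ + D * Pg * Ddᵀ) * flucCov (H₀ + D * Pg * Dᵀ) Q - P * (Dd * Dᵀ + D * Ddᵀ) * P =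
      (flucCov (H₀ + D * Pg * Dᵀ) Q - P) * Dd * Pg * Gh * Dᵀ + D * Gh * Pg * Ddᵀ * (flucCov (H₀ + D * Pg * Dᵀ) Q - P) +
        P * Dd * ((Gh - G₀) - (1 - Pg) * Gh) * Dᵀ + D * ((Gh - G₀) - Gh * (1 - Pg)) * Ddᵀ * P +
        D * Gh * Pg * Pd * (1 - Pg) * Dᵀ * flucCov (H₀ + D * Pg * Dᵀ) Q + flucCov (H₀ + D * Pg * Dᵀ) Q * D * (1 - Pg) * Pd * Pg * Gh * Dᵀ := by
  rw [cross_sandwich_sub h hH₀t hPt hGht hQ hH₀ hP hrange hGh hd hbf1 hbf2]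
  simp only [Matrix.mul_sub, Matrix.sub_mul, Matrix.mul_one, Matrix.one_mul, Matrix.mul_assoc]
  abel

/-- [our object] (P×) CONTRACTED with any co-leg `A` (e.g. `A = Ḣ_act[β]`): the cross loop `tr(A·Γ·Ṡ·Γ) − tr(A·P·Ṡ_BF·P)` is the sum of the eight
remainder loops. -/
theorem trace_cross_sub (h : IsUnit (kkt (H₀ + D * Pg * Dᵀ) Q).det) (hH₀t : H₀ᵀ = H₀) (hPt : Pgᵀ = Pg) (hGht : Ghᵀ = Gh)
    (hQ : Q * D * X = 0) (hH₀ : H₀ * D * X = 0) (hP : Pg * Pg = Pg) (hrange : Pg = Dᵀ * D * X * T) (hGh : Gh * (Dᵀ * D) * X = X)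
    (hd : Pd = Pd * Pg + Pg * Pd) (hbf1 : P * D = D * G₀) (hbf2 : Dᵀ * P = G₀ * Dᵀ) :
    (A * (flucCov (H₀ + D * Pg * Dᵀ) Q * (Dd * Pg * Dᵀ + D * Pd * Dᵀ + D * Pg * Ddᵀ) * flucCov (H₀ + D * Pg * Dᵀ) Q)).trace -
        (A * (P * (Dd * Dᵀ + D * Ddᵀ) * P)).trace =
      -(A * (flucCov (H₀ + D * Pg * Dᵀ) Q * Dd * (1 - Pg) * Gh * Dᵀ)).trace - (A * (D * Gh * (1 - Pg) * Ddᵀ * flucCov (H₀ + D * Pg * Dᵀ) Q)).trace +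
        (A * (flucCov (H₀ + D * Pg * Dᵀ) Q * Dd * (Gh - G₀) * Dᵀ)).trace + (A * (D * (Gh - G₀) * Ddᵀ * flucCov (H₀ + D * Pg * Dᵀ) Q)).trace -
        (A * ((P - flucCov (H₀ + D * Pg * Dᵀ) Q) * Dd * G₀ * Dᵀ)).trace - (A * (D * G₀ * Ddᵀ * (P - flucCov (H₀ + D * Pg * Dᵀ) Q))).trace +
        (A * (D * Gh * Pg * Pd * (1 - Pg) * Dᵀ * flucCov (H₀ + D * Pg * Dᵀ) Q)).trace +
        (A * (flucCov (H₀ + D * Pg * Dᵀ) Q * D * (1 - Pg) * Pd * Pg * Gh * Dᵀ)).trace := by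
  rw [← Matrix.trace_sub, ← Matrix.mul_sub, cross_sandwich_sub h hH₀t hPt hGht hQ hH₀ hP hrange hGh hd hbf1 hbf2]
  simp only [Matrix.mul_add, Matrix.mul_sub, Matrix.mul_neg, Matrix.trace_add, Matrix.trace_sub, Matrix.trace_neg]

/-- [our object] **(P∘) THE SLICE–SLICE BUBBLE PAIRING**: `tr(Γ·Ṡ·Γ·Ṡ) − tr(P·Ṡ_BF·P·Ṡ_BF) = tr((Γ·Ṡ·Γ − P·Ṡ_BF·P)·Ṡ) + tr(P·Ṡ_BF·P·(Ṡ − Ṡ_BF))`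
with the first factor = the eight remainders of (P×) and `Ṡ − Ṡ_BF` = (J1)'s `(1−Π)`∕`Π̇` list, `P·Ṡ_BF·P` = (K1). -/
theorem trace_slice_bubble_sub (hbf1 : P * D = D * G₀) (hbf2 : Dᵀ * P = G₀ * Dᵀ) :
    (flucCov (H₀ + D * Pg * Dᵀ) Q * (Dd * Pg * Dᵀ + D * Pd * Dᵀ + D * Pg * Ddᵀ) * flucCov (H₀ + D * Pg * Dᵀ) Q *
          (Dd * Pg * Dᵀ + D * Pd * Dᵀ + D * Pg * Ddᵀ)).trace -
        (P * (Dd * Dᵀ + D * Ddᵀ) * P * (Dd * Dᵀ + D * Ddᵀ)).trace =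
      ((flucCov (H₀ + D * Pg * Dᵀ) Q * (Dd * Pg * Dᵀ + D * Pd * Dᵀ + D * Pg * Ddᵀ) * flucCov (H₀ + D * Pg * Dᵀ) Q - P * (Dd * Dᵀ + D * Ddᵀ) * P) *
          (Dd * Pg * Dᵀ + D * Pd * Dᵀ + D * Pg * Ddᵀ)).trace +
        ((P * Dd * G₀ * Dᵀ + D * G₀ * Ddᵀ * P) * (-(Dd * (1 - Pg) * Dᵀ) + D * Pd * Dᵀ - D * (1 - Pg) * Ddᵀ)).trace := by
  rw [trace_bubble_sub, slice_jet_sub, bf_sandwich hbf1 hbf2]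

/-- [our object] **(P·) THE SLICE TADPOLE PAIRING**: `tr(Γ·S̈) − tr(P·S̈_BF) = tr(Γ·(S̈ − S̈_BF)) − tr(R·S̈_BF)` with `S̈ − S̈_BF` = (J2)'s list (GAMMA-4 PART 2's
`trace_flucCov_jet2_slice` reduces `tr(Γ·S̈)` further; (K2) reduces `tr(P·S̈_BF)`). -/
theorem trace_slice_tadpole_sub {Ddd : Matrix ν σ 𝕜} {Pdd : Matrix σ σ 𝕜} :
    (flucCov (H₀ + D * Pg * Dᵀ) Q *
          (Ddd * Pg * Dᵀ + D * Pg * Dddᵀ + D * Pdd * Dᵀ + (Dd * Pd * Dᵀ + Dd * Pd * Dᵀ) + (Dd * Pg * Ddᵀ + Dd * Pg * Ddᵀ) +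
            (D * Pd * Ddᵀ + D * Pd * Ddᵀ))).trace -
        (P * (Ddd * Dᵀ + D * Dddᵀ + (Dd * Ddᵀ + Dd * Ddᵀ))).trace =
      (flucCov (H₀ + D * Pg * Dᵀ) Q *
          (-(Ddd * (1 - Pg) * Dᵀ) - D * (1 - Pg) * Dddᵀ + D * Pdd * Dᵀ + (Dd * Pd * Dᵀ + Dd * Pd * Dᵀ) + (D * Pd * Ddᵀ + D * Pd * Ddᵀ) -
            (Dd * (1 - Pg) * Ddᵀ + Dd * (1 - Pg) * Ddᵀ))).trace -
        ((P - flucCov (H₀ + D * Pg * Dᵀ) Q) * (Ddd * Dᵀ + D * Dddᵀ + (Dd * Ddᵀ + Dd * Ddᵀ))).trace := by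
  rw [trace_tadpole_sub, slice_jet2_sub]

end Pairing

/-! ## §4 The structure of the leg remainder `R = P − Γ` (Wilson-BF instance letters) -/

section LegRemainder

variable {ν μ κ σ : Type*} [Fintype ν] [Fintype μ] [Fintype κ] [Fintype σ] [DecidableEq ν] [DecidableEq μ] [DecidableEq σ]
variable {H₀ P : Matrix ν ν 𝕜} {Q : Matrix μ ν 𝕜} {D : Matrix ν σ 𝕜} {Pg Gh G₀ : Matrix σ σ 𝕜} {X : Matrix σ κ 𝕜} {T : Matrix κ σ 𝕜}

omit [Fintype μ] [Fintype κ] [DecidableEq μ] in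
/-- [folklore] the covariant slice Hessian against the BF-Feynman left inverse: `P·(H₀ + D·Π·Dᵀ) = 1 − D·G₀·(1−Π)·Dᵀ`. -/
theorem bfLeg_mul_sliceHessian (hPl : P * (H₀ + D * Dᵀ) = 1) (hbf1 : P * D = D * G₀) :
    P * (H₀ + D * Pg * Dᵀ) = 1 - D * G₀ * (1 - Pg) * Dᵀ := by
  have e : H₀ + D * Pg * Dᵀ = (H₀ + D * Dᵀ) - D * (1 - Pg) * Dᵀ := by
    simp only [Matrix.mul_sub, Matrix.sub_mul, Matrix.mul_one]; abel
  rw [e, Matrix.mul_sub, hPl, ← Matrix.mul_assoc, ← Matrix.mul_assoc, hbf1]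

omit [Fintype μ] [Fintype κ] [DecidableEq μ] in
/-- [folklore] mirror: `(H₀ + D·Π·Dᵀ)·P = 1 − D·(1−Π)·G₀·Dᵀ`. -/
theorem sliceHessian_mul_bfLeg (hPr : (H₀ + D * Dᵀ) * P = 1) (hbf2 : Dᵀ * P = G₀ * Dᵀ) :
    (H₀ + D * Pg * Dᵀ) * P = 1 - D * (1 - Pg) * G₀ * Dᵀ := by
  have e : H₀ + D * Pg * Dᵀ = (H₀ + D * Dᵀ) - D * (1 - Pg) * Dᵀ := by
    simp only [Matrix.mul_sub, Matrix.sub_mul, Matrix.mul_one]; abel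
  rw [e, Matrix.sub_mul, hPr, Matrix.mul_assoc (D * (1 - Pg)), hbf2, ← Matrix.mul_assoc]

omit [Fintype κ] in
/-- [our object] **(R1) THE LEG REMAINDER**: `P − Γ = −D·G₀·(1−Π)·Dᵀ·Γ + P·Qᵀ·𝓘ᴸ` — a `(1−Π)`-gauge piece plus the BF leg running into the CONSTRAINT
vertex `Qᵀ` with the left-minimiser leg (`(H₀ + DΠDᵀ)·Γ + Qᵀ·𝓘ᴸ = 1` multiplied by `P`). -/
theorem legRem_eq (h : IsUnit (kkt (H₀ + D * Pg * Dᵀ) Q).det) (hPl : P * (H₀ + D * Dᵀ) = 1) (hbf1 : P * D = D * G₀) :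
    P - flucCov (H₀ + D * Pg * Dᵀ) Q =
      -(D * G₀ * (1 - Pg) * Dᵀ * flucCov (H₀ + D * Pg * Dᵀ) Q) + P * Qᵀ * minOpL (H₀ + D * Pg * Dᵀ) Q := by
  have e : P * ((H₀ + D * Pg * Dᵀ) * flucCov (H₀ + D * Pg * Dᵀ) Q + Qᵀ * minOpL (H₀ + D * Pg * Dᵀ) Q) = P := by
    rw [(kkt_mul_blocks (H₀ + D * Pg * Dᵀ) Q h).1, Matrix.mul_one]
  apply sub_eq_neg_add_of_eq
  calc flucCov (H₀ + D * Pg * Dᵀ) Q - D * G₀ * (1 - Pg) * Dᵀ * flucCov (H₀ + D * Pg * Dᵀ) Q + P * Qᵀ * minOpL (H₀ + D * Pg * Dᵀ) Q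
        = (1 - D * G₀ * (1 - Pg) * Dᵀ) * flucCov (H₀ + D * Pg * Dᵀ) Q + P * Qᵀ * minOpL (H₀ + D * Pg * Dᵀ) Q := by
          rw [Matrix.sub_mul, Matrix.one_mul]
    _ = P * (H₀ + D * Pg * Dᵀ) * flucCov (H₀ + D * Pg * Dᵀ) Q + P * Qᵀ * minOpL (H₀ + D * Pg * Dᵀ) Q := by rw [bfLeg_mul_sliceHessian hPl hbf1]
    _ = P := by rw [Matrix.mul_assoc P (H₀ + D * Pg * Dᵀ), Matrix.mul_assoc P Qᵀ, ← Matrix.mul_add]; exact e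

omit [Fintype κ] in
/-- [our object] (R1, mirror) `P − Γ = −Γ·D·(1−Π)·G₀·Dᵀ + 𝓘·Q·P` (`Γ·(H₀ + DΠDᵀ) + 𝓘·Q = 1` multiplied by `P` on the right). -/
theorem legRem_eq' (h : IsUnit (kkt (H₀ + D * Pg * Dᵀ) Q).det) (hPr : (H₀ + D * Dᵀ) * P = 1) (hbf2 : Dᵀ * P = G₀ * Dᵀ) :
    P - flucCov (H₀ + D * Pg * Dᵀ) Q =
      -(flucCov (H₀ + D * Pg * Dᵀ) Q * D * (1 - Pg) * G₀ * Dᵀ) + minOp (H₀ + D * Pg * Dᵀ) Q * Q * P := by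
  have e : (flucCov (H₀ + D * Pg * Dᵀ) Q * (H₀ + D * Pg * Dᵀ) + minOp (H₀ + D * Pg * Dᵀ) Q * Q) * P = P := by
    rw [(blocks_mul_kkt (H₀ + D * Pg * Dᵀ) Q h).1, Matrix.one_mul]
  apply sub_eq_neg_add_of_eq
  calc flucCov (H₀ + D * Pg * Dᵀ) Q - flucCov (H₀ + D * Pg * Dᵀ) Q * D * (1 - Pg) * G₀ * Dᵀ + minOp (H₀ + D * Pg * Dᵀ) Q * Q * P
        = flucCov (H₀ + D * Pg * Dᵀ) Q * (1 - D * (1 - Pg) * G₀ * Dᵀ) + minOp (H₀ + D * Pg * Dᵀ) Q * Q * P := by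
          conv_rhs => rw [Matrix.mul_sub, Matrix.mul_one]
          simp only [Matrix.mul_assoc]
    _ = flucCov (H₀ + D * Pg * Dᵀ) Q * ((H₀ + D * Pg * Dᵀ) * P) + minOp (H₀ + D * Pg * Dᵀ) Q * Q * P := by rw [sliceHessian_mul_bfLeg hPr hbf2]
    _ = P := by rw [← Matrix.mul_assoc, ← Matrix.add_mul]; exact e

omit [Fintype μ] [Fintype κ] [DecidableEq μ] [DecidableEq σ] in
/-- [folklore] **(R4)** `H₀·P = 1 − D·G₀·Dᵀ`: the invariant Hessian against the BF-Feynman leg leaves the full-ghost longitudinal projector. -/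
theorem H₀_mul_bfLeg (hPr : (H₀ + D * Dᵀ) * P = 1) (hbf2 : Dᵀ * P = G₀ * Dᵀ) : H₀ * P = 1 - D * G₀ * Dᵀ := by
  have e : H₀ * P = (H₀ + D * Dᵀ) * P - D * (Dᵀ * P) := by rw [Matrix.add_mul, Matrix.mul_assoc]; abel
  rw [e, hPr, hbf2, ← Matrix.mul_assoc]

omit [DecidableEq σ] in
/-- [our object] **(R5)** `H₀·Γ = 1 − D·Π·Gh·Dᵀ − Qᵀ·𝓘ᴸ`: the invariant Hessian against the fluctuation covariance leaves the constrained-ghost slice projector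
and the constraint vertex (first `kkt` block row + (W2)). -/
theorem H₀_mul_flucCov (h : IsUnit (kkt (H₀ + D * Pg * Dᵀ) Q).det) (hH₀t : H₀ᵀ = H₀) (hPt : Pgᵀ = Pg) (hGht : Ghᵀ = Gh) (hQ : Q * D * X = 0)
    (hH₀ : H₀ * D * X = 0) (hP : Pg * Pg = Pg) (hrange : Pg = Dᵀ * D * X * T) (hGh : Gh * (Dᵀ * D) * X = X) :
    H₀ * flucCov (H₀ + D * Pg * Dᵀ) Q = 1 - D * Pg * Gh * Dᵀ - Qᵀ * minOpL (H₀ + D * Pg * Dᵀ) Q := by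
  have k1 := (kkt_mul_blocks (H₀ + D * Pg * Dᵀ) Q h).1
  have w2 := proj_Dt_flucCov h hH₀t hPt hGht hQ hH₀ hP hrange hGh
  have e : H₀ * flucCov (H₀ + D * Pg * Dᵀ) Q = ((H₀ + D * Pg * Dᵀ) * flucCov (H₀ + D * Pg * Dᵀ) Q + Qᵀ * minOpL (H₀ + D * Pg * Dᵀ) Q) -
      D * (Pg * Dᵀ * flucCov (H₀ + D * Pg * Dᵀ) Q) - Qᵀ * minOpL (H₀ + D * Pg * Dᵀ) Q := by simp only [Matrix.add_mul, Matrix.mul_assoc]; abel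
  rw [e, k1, w2, ← Matrix.mul_assoc, ← Matrix.mul_assoc]

/-- [our object] **(R2) THE INVARIANT HESSIAN COLLAPSES THE LEG REMAINDER**: `H₀·(P − Γ) = D·(Gh − G₀)·Dᵀ − D·(1−Π)·Gh·Dᵀ + Qᵀ·𝓘ᴸ` — onto the ghost
remainder `E`, a `(1−Π)` piece and the constraint vertex ((R4) − (R5)). -/
theorem H₀_mul_legRem (h : IsUnit (kkt (H₀ + D * Pg * Dᵀ) Q).det) (hH₀t : H₀ᵀ = H₀) (hPt : Pgᵀ = Pg) (hGht : Ghᵀ = Gh) (hQ : Q * D * X = 0)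
    (hH₀ : H₀ * D * X = 0) (hP : Pg * Pg = Pg) (hrange : Pg = Dᵀ * D * X * T) (hGh : Gh * (Dᵀ * D) * X = X) (hPr : (H₀ + D * Dᵀ) * P = 1)
    (hbf2 : Dᵀ * P = G₀ * Dᵀ) :
    H₀ * (P - flucCov (H₀ + D * Pg * Dᵀ) Q) = D * (Gh - G₀) * Dᵀ - D * (1 - Pg) * Gh * Dᵀ + Qᵀ * minOpL (H₀ + D * Pg * Dᵀ) Q := by
  rw [Matrix.mul_sub, H₀_mul_bfLeg hPr hbf2, H₀_mul_flucCov h hH₀t hPt hGht hQ hH₀ hP hrange hGh]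
  simp only [Matrix.mul_sub, Matrix.sub_mul, Matrix.mul_one, Matrix.mul_assoc]
  abel

omit [Fintype κ] in
/-- [our object] **(R2′)** `H₀·(P − Γ) = (1 − D·G₀·Dᵀ)·Qᵀ·𝓘ᴸ` — the same collapse read through (R1): only the constraint vertex survives, dressed by the
full-ghost longitudinal projector (uses `H₀·D = 0`). -/
theorem H₀_mul_legRem' (h : IsUnit (kkt (H₀ + D * Pg * Dᵀ) Q).det) (hH₀D : H₀ * D = 0) (hPl : P * (H₀ + D * Dᵀ) = 1) (hPr : (H₀ + D * Dᵀ) * P = 1)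
    (hbf1 : P * D = D * G₀) (hbf2 : Dᵀ * P = G₀ * Dᵀ) :
    H₀ * (P - flucCov (H₀ + D * Pg * Dᵀ) Q) = (1 - D * G₀ * Dᵀ) * Qᵀ * minOpL (H₀ + D * Pg * Dᵀ) Q := by
  rw [legRem_eq h hPl hbf1, Matrix.mul_add, Matrix.mul_neg]
  have z : H₀ * (D * G₀ * (1 - Pg) * Dᵀ * flucCov (H₀ + D * Pg * Dᵀ) Q) = 0 := by
    rw [show D * G₀ * (1 - Pg) * Dᵀ * flucCov (H₀ + D * Pg * Dᵀ) Q = D * (G₀ * (1 - Pg) * Dᵀ * flucCov (H₀ + D * Pg * Dᵀ) Q) by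
      simp only [Matrix.mul_assoc], ← Matrix.mul_assoc, hH₀D, Matrix.zero_mul]
  rw [z, neg_zero, zero_add, ← Matrix.mul_assoc, ← Matrix.mul_assoc, H₀_mul_bfLeg hPr hbf2]

/-- [our object] **(R3) THE DIVERGENCE OF THE LEG REMAINDER IS PURE GHOST-REMAINDER + `(1−Π)`**: `Dᵀ·(P − Γ) = −(Gh − G₀)·Dᵀ + (1−Π)·(Gh·Dᵀ − Dᵀ·Γ)`
((bf2) and (W2) on the `Π`-component of `Dᵀ·Γ`). -/
theorem Dt_mul_legRem (h : IsUnit (kkt (H₀ + D * Pg * Dᵀ) Q).det) (hH₀t : H₀ᵀ = H₀) (hPt : Pgᵀ = Pg) (hGht : Ghᵀ = Gh) (hQ : Q * D * X = 0)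
    (hH₀ : H₀ * D * X = 0) (hP : Pg * Pg = Pg) (hrange : Pg = Dᵀ * D * X * T) (hGh : Gh * (Dᵀ * D) * X = X) (hbf2 : Dᵀ * P = G₀ * Dᵀ) :
    Dᵀ * (P - flucCov (H₀ + D * Pg * Dᵀ) Q) =
      -((Gh - G₀) * Dᵀ) + (1 - Pg) * (Gh * Dᵀ - Dᵀ * flucCov (H₀ + D * Pg * Dᵀ) Q) := by
  have w2 := proj_Dt_flucCov h hH₀t hPt hGht hQ hH₀ hP hrange hGh
  have e : Dᵀ * flucCov (H₀ + D * Pg * Dᵀ) Q = Pg * Dᵀ * flucCov (H₀ + D * Pg * Dᵀ) Q + (1 - Pg) * Dᵀ * flucCov (H₀ + D * Pg * Dᵀ) Q := by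
    simp only [Matrix.sub_mul, Matrix.one_mul]
    abel
  conv_lhs => rw [Matrix.mul_sub, hbf2, e, w2]
  simp only [Matrix.mul_sub, Matrix.sub_mul, Matrix.one_mul, Matrix.mul_assoc]
  abel

/-- [our object] (R3, mirror) `(P − Γ)·D = −D·(Gh − G₀) + (D·Gh − Γ·D)·(1−Π)` ((bf1) and (W1)). -/
theorem legRem_mul_D (h : IsUnit (kkt (H₀ + D * Pg * Dᵀ) Q).det) (hQ : Q * D * X = 0) (hH₀ : H₀ * D * X = 0) (hP : Pg * Pg = Pg)
    (hrange : Pg = Dᵀ * D * X * T) (hGh : Gh * (Dᵀ * D) * X = X) (hbf1 : P * D = D * G₀) :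
    (P - flucCov (H₀ + D * Pg * Dᵀ) Q) * D = -(D * (Gh - G₀)) + (D * Gh - flucCov (H₀ + D * Pg * Dᵀ) Q * D) * (1 - Pg) := by
  have w1 := flucCov_D_proj h hQ hH₀ hP hrange hGh
  have e : flucCov (H₀ + D * Pg * Dᵀ) Q * D = flucCov (H₀ + D * Pg * Dᵀ) Q * D * Pg + flucCov (H₀ + D * Pg * Dᵀ) Q * D * (1 - Pg) := by
    simp only [Matrix.mul_sub, Matrix.mul_one]
    abel
  conv_lhs => rw [Matrix.sub_mul, hbf1, e, w1]
  simp only [Matrix.mul_sub, Matrix.sub_mul, Matrix.mul_one, Matrix.mul_assoc]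
  abel

end LegRemainder

/-! ## §5 The vertex-Ward reduction of the cross `R`-term (abstract contact letter) -/

section VertexWard

variable {ν μ σ : Type*} [Fintype ν] [Fintype μ] [Fintype σ] [DecidableEq ν] [DecidableEq μ] [DecidableEq σ]
variable {H₀ P A : Matrix ν ν 𝕜} {Q : Matrix μ ν 𝕜} {D Dd Dd' Ct : Matrix ν σ 𝕜} {Pg G₀ : Matrix σ σ 𝕜}

omit [Fintype μ] [DecidableEq ν] [DecidableEq μ] [DecidableEq σ] in
/-- [our object] **THE VERTEX-WARD REDUCTION, abstract form**: under the contact letter (VW) `A·D = −(H₀·ḋ + Ct)` («cubic jet ∘ gradient = commutator with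
the quadratic form», the model of H2V-DESIGN §2 (a4)+(a6); `Ct` abstract) and `Aᵀ = A`, `H₀ᵀ = H₀`, for ANY leg `R`:
`tr(A·R·ḋ′·G₀·Dᵀ) = −tr(ḋᵀ·H₀·R·ḋ′·G₀) − tr(Ctᵀ·R·ḋ′·G₀)` — the action 3-jet with a pure-gauge leg becomes `H₀`×(local) + contact. -/
theorem trace_vertexWard (hAt : Aᵀ = A) (hH₀t : H₀ᵀ = H₀) (hVW : A * D = -(H₀ * Dd + Ct)) (R : Matrix ν ν 𝕜) :
    (A * R * Dd' * G₀ * Dᵀ).trace = -(Ddᵀ * H₀ * R * Dd' * G₀).trace - (Ctᵀ * R * Dd' * G₀).trace := by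
  have hDA : Dᵀ * A = -(Ddᵀ * H₀ + Ctᵀ) := by
    simpa only [Matrix.transpose_mul, hAt, Matrix.transpose_neg, Matrix.transpose_add, hH₀t] using congrArg Matrix.transpose hVW
  rw [Matrix.trace_mul_comm, show Dᵀ * (A * R * Dd' * G₀) = Dᵀ * A * (R * Dd' * G₀) by simp only [Matrix.mul_assoc], hDA]
  simp only [Matrix.neg_mul, Matrix.add_mul, Matrix.trace_neg, Matrix.trace_add, Matrix.mul_assoc]
  abel

/-- [our object] **THE CROSS `R`-TERM OF (P×) REDUCED** (Wilson-BF instance + (VW)): with `R = P − Γ`,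
`tr(A·R·ḋ′·G₀·Dᵀ) = −tr(ḋᵀ·(1 − D·G₀·Dᵀ)·Qᵀ·𝓘ᴸ·ḋ′·G₀) − tr(Ctᵀ·R·ḋ′·G₀)` — by (R2′) the `H₀`-leg COLLAPSES onto the constraint vertex: what is left of
the leg remainder in the cross loop is a constraint-vertex loop and the contact loop (their letters ∕ power counting are GAMMA-6's business, not asserted). -/
theorem trace_cross_legRem_vertexWard (h : IsUnit (kkt (H₀ + D * Pg * Dᵀ) Q).det) (hAt : Aᵀ = A) (hH₀t : H₀ᵀ = H₀) (hH₀D : H₀ * D = 0)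
    (hPl : P * (H₀ + D * Dᵀ) = 1) (hPr : (H₀ + D * Dᵀ) * P = 1) (hbf1 : P * D = D * G₀) (hbf2 : Dᵀ * P = G₀ * Dᵀ) (hVW : A * D = -(H₀ * Dd + Ct)) :
    (A * (P - flucCov (H₀ + D * Pg * Dᵀ) Q) * Dd' * G₀ * Dᵀ).trace =
      -(Ddᵀ * ((1 - D * G₀ * Dᵀ) * Qᵀ * minOpL (H₀ + D * Pg * Dᵀ) Q) * Dd' * G₀).trace -
        (Ctᵀ * (P - flucCov (H₀ + D * Pg * Dᵀ) Q) * Dd' * G₀).trace := by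
  rw [trace_vertexWard hAt hH₀t hVW, Matrix.mul_assoc Ddᵀ H₀, H₀_mul_legRem' h hH₀D hPl hPr hbf1 hbf2]

end VertexWard

end Summit.QuantumFields.BalabanUV.Beta.FP.SlicePairing
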